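import Summits.Parity.GeneralizedHardyLittlewood.Theorems.GreenTaoLevelTwoMNTwoPropNineteenOfInverse

/-!
# Route `GreenTaoLevelTwo`, crux `MNTwo` (stmt-Parity-21276), line `birth`, stub `stub_mnVertical`:
# the "all `N ≥ 2`" major-arc inverse statement `hInv` is unsatisfiable (negative lemma)

Block V4–V5 bookkeeping for the `stub_mnVertical` census (B. Green, T. Tao, *Quadratic uniformity
of the Möbius function*, Ann. Inst. Fourier 58 (2008) = arXiv:math/0606087, §10: "Assume that `N`
is large depending on `A`" in Lemmas 23 and 24).  The hypothesis `hInv k` of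
`…MNTwoPropNineteenOfInverse.propNineteen_of_majorArcInverse k` asks, for EVERY `N ≥ 2`, that a
large sum `‖Σ_{N<n≤2N} μψe(−φ)‖ ≥ N/log^A N` force a major-arc datum with
`(log N)^{-B} ≤ ρ₃ ≤ ρ`.  For `N` small against `A` this fails: with `N = 9`, `A = 7`
(`log 9 > 2`, so `9/log⁷ 9 < 1/9`), the weight `ψ = (1/9)·1_{13}` (a single prime), `φ = 0`,
`α = 0` and `ρ = min(10⁻⁶, (log 9)^{-B}/2)` all hypotheses hold while `ρ < (log 9)^{-B}`.  Hence
the target of the chain must be the large-`N` form `hInvL` of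
`…MNTwoVerticalOfInverseLargeN.stub_mnVertical_of_majorArcInverse_largeN`.  Def-free:

* `majorArcInverse_allN_false` — `¬ hInv k` for every torus dimension `k`.

References: [GreenTao2008QuadraticMobius] arXiv:math/0606087 §10 (Lemmas 23, 24: `N` large).
-/

noncomputable section

open Finset Real ArithmeticFunction
open scoped ArithmeticFunction.Moebius FourierTransform

namespace Summit.Parity.GeneralizedHardyLittlewood.GreenTaoLevelTwoMNTwoMajorArcInverseSmallN

/-- `2 < log 9` (from `e < 2.7182818286`). [folklore] -/
theorem two_lt_log_nine : (2 : ℝ) < Real.log 9 := by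
  rw [Real.lt_log_iff_exp_lt (by norm_num)]
  have h := Real.exp_one_lt_d9
  have h0 : 0 < Real.exp 1 := Real.exp_pos 1
  calc Real.exp 2 = Real.exp 1 * Real.exp 1 := by rw [← Real.exp_add]; norm_num
    _ < 2.7182818286 * 2.7182818286 := by nlinarith
    _ < 9 := by norm_num

/-- **The "all `N ≥ 2`" inverse statement `hInv k` is false** (for every `k`): witness `N = 9`,
`A = 7`, `α = 0`, `n₀ = 13`, `φ = 0`, `ψ = (1/9)·1_{13}`, `ρ = min(10⁻⁶, (log 9)^{-B}/2)`.
[cite: GreenTao2008QuadraticMobius, §10 ("Assume that `N` is large depending on `A`")] -/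
theorem majorArcInverse_allN_false (k : ℕ) :
    ¬ (∀ A : ℝ, 0 < A → ∃ B : ℝ, 0 ≤ B ∧ ∀ N : ℕ, 2 ≤ N → ∀ (α : Fin k → ℝ) (n₀ : ℤ) (ρ : ℝ),
      0 < ρ → 100000 * ρ < 1 →
      (∀ n : ℤ, ((∀ i, ‖((((n - n₀ : ℤ) : ℝ) * α i : ℝ) : AddCircle (1 : ℝ))‖ +
          |((n - n₀ : ℤ) : ℝ)| / N < 100 * ρ) ∧ |((n - n₀ : ℤ) : ℝ)| / N < 100 * ρ) →
        (N : ℤ) < n ∧ n ≤ 2 * N) →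
      ∀ φ : ℤ → ℝ,
        (∀ n h₁ h₂ h₃ : ℤ,
          (∀ e₁ e₂ e₃ : ℕ, e₁ ≤ 1 → e₂ ≤ 1 → e₃ ≤ 1 →
            (∀ i, ‖((((n + e₁ * h₁ + e₂ * h₂ + e₃ * h₃ - n₀ : ℤ) : ℝ) * α i : ℝ) :
                AddCircle (1 : ℝ))‖ +
              |((n + e₁ * h₁ + e₂ * h₂ + e₃ * h₃ - n₀ : ℤ) : ℝ)| / N < 100 * ρ) ∧
            |((n + e₁ * h₁ + e₂ * h₂ + e₃ * h₃ - n₀ : ℤ) : ℝ)| / N < 100 * ρ) →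
          ∃ z : ℤ, φ (n + h₁ + h₂ + h₃) - φ (n + h₁ + h₂) - φ (n + h₁ + h₃) - φ (n + h₂ + h₃)
            + φ (n + h₁) + φ (n + h₂) + φ (n + h₃) - φ n = z) →
        ∀ ψ : ℤ → ℝ, (∀ n, 0 ≤ ψ n) →
          (∀ n, ψ n ≠ 0 →
            (∀ i, ‖((((n - n₀ : ℤ) : ℝ) * α i : ℝ) : AddCircle (1 : ℝ))‖ +
                |((n - n₀ : ℤ) : ℝ)| / N < ρ) ∧ |((n - n₀ : ℤ) : ℝ)| / N < ρ) →
          (∀ (n n' : ℤ) (t : ℝ), 0 ≤ t →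
            (∀ i, ‖((((n - n' : ℤ) : ℝ) * α i : ℝ) : AddCircle (1 : ℝ))‖ ≤ t) →
              |ψ n - ψ n'| ≤ t + |((n - n' : ℤ) : ℝ)| / N) →
          (N : ℝ) / Real.log N ^ A ≤
            ‖∑ n ∈ Ioc N (2 * N), ((μ n : ℝ) : ℂ) * ((ψ n : ℝ) : ℂ) * (𝐞 (-(φ n)) : ℂ)‖ →
          ∃ (q : ℕ) (K ρ₃ : ℝ), 1 ≤ q ∧ (q : ℝ) ≤ Real.log N ^ B ∧ 0 ≤ K ∧ K ≤ Real.log N ^ B ∧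
            (Real.log N ^ B)⁻¹ ≤ ρ₃ ∧ ρ₃ ≤ ρ ∧
            ∀ a b : ℤ,
              (⨆ i : Fin k, ‖(((a : ℝ) * α i : ℝ) : AddCircle (1 : ℝ))‖) + |(a : ℝ)| / N < ρ₃ →
              (⨆ i : Fin k, ‖(((b : ℝ) * α i : ℝ) : AddCircle (1 : ℝ))‖) + |(b : ℝ)| / N < ρ₃ →
              ‖q • ((((φ (n₀ + a + b) : ℝ) : UnitAddCircle)) - ((φ (n₀ + a) : ℝ) : UnitAddCircle)
                - ((φ (n₀ + b) : ℝ) : UnitAddCircle) + ((φ n₀ : ℝ) : UnitAddCircle))‖ ≤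
                K * ((⨆ i : Fin k, ‖(((a : ℝ) * α i : ℝ) : AddCircle (1 : ℝ))‖) + |(a : ℝ)| / N) *
                  ((⨆ i : Fin k, ‖(((b : ℝ) * α i : ℝ) : AddCircle (1 : ℝ))‖) + |(b : ℝ)| / N)) := by
  intro h
  obtain ⟨B, hB0, hB⟩ := h 7 (by norm_num)
  -- the witness
  have hlog9 : 0 < Real.log 9 := by linarith [two_lt_log_nine]
  have hLB : 0 < Real.log (9 : ℕ) ^ B := by
    push_cast; exact Real.rpow_pos_of_pos hlog9 B
  set ρ : ℝ := min (1 / 1000000) ((Real.log (9 : ℕ) ^ B)⁻¹ / 2) with hρdef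
  have hρpos : 0 < ρ := lt_min (by norm_num) (by positivity)
  have hρ6 : ρ ≤ 1 / 1000000 := min_le_left _ _
  have hρB : ρ ≤ (Real.log (9 : ℕ) ^ B)⁻¹ / 2 := min_le_right _ _
  set α : Fin k → ℝ := fun _ => 0 with hαdef
  set φ : ℤ → ℝ := fun _ => 0 with hφdef
  set ψ : ℤ → ℝ := fun n => if n = 13 then 1 / 9 else 0 with hψdef
  have hψval : ∀ n, ψ n = 0 ∨ ψ n = 1 / 9 := fun n => by
    simp only [hψdef]; split_ifs <;> simp
  -- integers at distance `< 1` coincide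
  have hint : ∀ n : ℤ, |((n - 13 : ℤ) : ℝ)| / (9 : ℕ) < 100 * ρ → n = 13 := by
    intro n hn
    have h1 : |((n - 13 : ℤ) : ℝ)| < 1 := by
      rw [div_lt_iff₀ (by norm_num)] at hn
      push_cast at hn ⊢
      nlinarith
    have h2 : |(n - 13 : ℤ)| < 1 := by
      rw [← Int.cast_abs] at h1
      exact_mod_cast h1
    have := Int.abs_lt_one_iff.mp h2
    omega
  obtain ⟨q, K, ρ₃, -, -, -, -, hρ₃B, hρ₃ρ, -⟩ := hB 9 (by norm_num) α 13 ρ hρpos (by linarith)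
    (fun n hn => by have := hint n hn.2; subst this; norm_num)
    φ (fun n h₁ h₂ h₃ _ => ⟨0, by simp [hφdef]⟩)
    ψ (fun n => by rcases hψval n with h | h <;> norm_num [h])
    (fun n hn => by
      have hn13 : n = 13 := by
        by_contra hne; exact hn (by simp [hψdef, hne])
      subst hn13
      refine ⟨fun i => ?_, ?_⟩
      · simp only [hαdef, mul_zero, sub_self, Int.cast_zero, abs_zero, zero_div, add_zero,
          AddCircle.coe_zero, norm_zero]
        exact hρpos
      · simp only [sub_self, Int.cast_zero, abs_zero, zero_div]; exact hρpos)
    (fun n n' t ht _ => by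
      by_cases hnn : n = n'
      · subst hnn; simp only [sub_self, abs_zero]; positivity
      · have h1 : (1 : ℝ) ≤ |((n - n' : ℤ) : ℝ)| := by
          rw [← Int.cast_abs]
          have : (1 : ℤ) ≤ |n - n'| := Int.one_le_abs (sub_ne_zero.mpr hnn)
          exact_mod_cast this
        have h2 : |ψ n - ψ n'| ≤ 1 / 9 := by
          rcases hψval n with h | h <;> rcases hψval n' with h' | h' <;> rw [h, h'] <;> norm_num
        have h3 : (1 : ℝ) / 9 ≤ |((n - n' : ℤ) : ℝ)| / (9 : ℕ) := by
          rw [show ((9 : ℕ) : ℝ) = 9 by norm_num, div_le_div_iff_of_pos_right (by norm_num)]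
          exact h1
        linarith)
    (by
      -- the sum is `μ(13) ψ(13) = −1/9`, of norm `1/9 ≥ 9/log⁷ 9`
      have hsum : ∑ n ∈ Ioc 9 (2 * 9), ((μ n : ℝ) : ℂ) * ((ψ n : ℝ) : ℂ) * (𝐞 (-(φ n)) : ℂ) =
          ((μ 13 : ℝ) : ℂ) * (((1 / 9 : ℝ)) : ℂ) * (𝐞 (-(φ 13)) : ℂ) := by
        rw [Finset.sum_eq_single_of_mem 13 (by decide)]
        · simp [hψdef]
        · intro b _ hb
          have : ψ (b : ℤ) = 0 := by
            simp only [hψdef]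
            rw [if_neg]
            exact_mod_cast hb
          rw [this]; simp
      rw [hsum]
      have h13 : μ 13 = -1 := ArithmeticFunction.moebius_apply_prime (by norm_num)
      have hnorm : ‖((μ 13 : ℝ) : ℂ) * (((1 / 9 : ℝ)) : ℂ) * (𝐞 (-(φ 13)) : ℂ)‖ = 1 / 9 := by
        rw [h13, norm_mul, norm_mul, Circle.norm_coe, mul_one, Complex.norm_real, Complex.norm_real]
        norm_num
      rw [hnorm]
      -- `9 / log 9 ^ 7 ≤ 1/9`
      have h7 : (2 : ℝ) ^ (7 : ℝ) ≤ Real.log 9 ^ (7 : ℝ) :=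
        Real.rpow_le_rpow (by norm_num) two_lt_log_nine.le (by norm_num)
      have h128 : (2 : ℝ) ^ (7 : ℝ) = 128 := by
        rw [show (7 : ℝ) = ((7 : ℕ) : ℝ) by norm_num, Real.rpow_natCast]; norm_num
      rw [h128] at h7
      have hpos : (0 : ℝ) < Real.log 9 ^ (7 : ℝ) := by linarith
      rw [show ((9 : ℕ) : ℝ) = 9 by norm_num, div_le_iff₀ hpos]
      nlinarith)
  -- contradiction: `(log 9 ^ B)⁻¹ ≤ ρ₃ ≤ ρ ≤ (log 9 ^ B)⁻¹ / 2`
  have : (Real.log (9 : ℕ) ^ B)⁻¹ > 0 := by positivity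
  linarith

end Summit.Parity.GeneralizedHardyLittlewood.GreenTaoLevelTwoMNTwoMajorArcInverseSmallN
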